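/-
Copyright (c) 2026 the pub-hodgecm-mathlib formalisation cell (harness21).  Prover seat hodgecm-mathlib-K2E5-p17 (g4), Track B «K2-LIT» ∕ h413
(`stmt-HodgeConjecture-24833`), line `K2_E3_EllipticInputs`, unit U12 «Characters», road «GL-[M6]-sc» (line lead K2E3-p23 (g5), MEMO «M6sc-ROAD v2» §2,
RULINGS #7 (M7-3) 2026-09-04T06:32Z), brick B4-E1: «CUSP-FORM CANCELLATION ALONG THE ABELIAN UNIPOTENT RADICALS `N_P`, `N̄_P` OF THE MAXIMAL PARABOLIC
`P_{(2,1)}` OF `GL₃(F)` AT A REGULAR ELEMENT OF ITS LEVI `GL₂ × GL₁`» (the (T_E) twin of Harish-Chandra's Theorem 20 substitution).  2026-09-04.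
-/
import Literature.NumberTheory.Automorphic.GLnTwoBlockUnipotentHaarTransport     -- ★ `exists_homeomorph_unipotentRadicalGL_conj_eq` (the twisted commutator `u ↦ u p u⁻¹ p⁻¹` on `U_c`, module `‖det(1 − K_p)‖`)
import Literature.NumberTheory.Automorphic.GLnTwoBlockLeviStructure              -- ★ `mem_standardLeviGL_iff`
import Mathlib.LinearAlgebra.Matrix.Charpoly.Coeff
import HarnessLib

/-!
# K2_E3 road (h413), U12 «Characters», brick B4-E1: cusp-form cancellation along `N_{(2,1)}` and `N̄_{(2,1)}` in `GL₃(F)`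

Cell `pub/hodgecm-mathlib` (D-0151), Track B, seat K2E5-p17 (g4) (free E5 hand serving the E3 road «GL-[M6]-sc» by name); line lead K2E3-p23 (g5), dealer
K2E3-plan (g3).  `--supports stmt-HodgeConjecture-24833 --as helper`; THEOREMS ONLY (no definition ∕ instance ∕ notation ∕ named fact ∕ `sorry`); never imports
`Cruxes/…/Lines`.  COUNT-NEUTRAL.  Consumer: B4-E2 `K2E3GL3TruncatedCharMixedTorus` (the non-elliptic estimates `hcanc` for the mixed torus `T_E = E^× × F^× ≤
M = GL₂ × GL₁`), with the cusp hypothesis `hcusp` delivered by B4-J `K2E3GL3SupercuspidalJacquetVanishing` (K2E3-p21 (g5)) in the shape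
«`∀ x y, ∫ u : ↥N, θ̃ (x * u * y) ∂ν = 0`».

THE MATHEMATICS [HarishChandra1970, Part VII §2 (proof of Thm. 20) and §8 Lemma 57; Rogawski1990, proof of Lemma 4.13.1 p. 70 «by a change of variables»].
Let `P = M U` be a two-block parabolic of `GL_n(F)`, `p ∈ P` with `det(1 − Ad(p)|_𝔲) ≠ 0`.  The twisted commutator `T(u) = u p u⁻¹ p⁻¹` is a homeomorphism of the
abelian group `U ≅ F^{I×J}` (it is the linear map `1 − K_p` in the box chart) scaling Haar measure by `‖det(1 − K_p)‖⁻¹` — ★ `exists_homeomorph_unipotentRadicalGL_conj_eq`.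
Hence for any `θ` and any cusp datum along `U`,
  `∫_U θ(x · u p u⁻¹ · y) du = ∫_U θ(x · T(u) · (p y)) du = ‖det(1 − K_p)‖⁻¹ ∫_U θ(x · u · (p y)) du = 0`:
**the `U`-orbit integral of a cusp form through a `U`-regular point vanishes** (§1, any `n`, any two-block `c`).  For `GL₃` and `M = GL₂ × GL₁ ∋ t = diag(A, λ)`
the regularity `det(1 − K_t) ≠ 0` reads `χ_A(λ) ≠ 0` («`λ` is not an eigenvalue of `A`» — automatic for `t` regular in the mixed torus `E^× × F^×`) both for
`U = N_{(2,1)}` (`K_t = λ⁻¹A`, `det(1 − K_t) = λ⁻² χ_A(λ)`, §2) and for the opposite radical `N̄_{(2,1)}` (`K_t = λ (A⁻¹)ᵀ`, `det(1 − K_t)·det A = χ_A(λ)`, §3).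
* §1 `integral_unipotent_conj_eq_zero_of_cuspForm` (+ `∀ x y` form) — generic two-block.
* §2 `det_one_sub_boxAd_parabolic21`, **`integral_unipotentRadical21_conj_eq_zero_of_cuspForm`** — `c = (false,false,true)`, `U = N_{(2,1)}`.
* §3 `det_one_sub_boxAd_oppositeParabolic21_mul_det`, **`integral_oppositeUnipotentRadical21_conj_eq_zero_of_cuspForm`** — `c = (true,true,false)`, `U = N̄_{(2,1)}`.

HONEST LABEL: HC_CM is proved only modulo the 7 printed citations (2 remaining named inputs: hLiu418 = stmt-HodgeConjecture-24832, h413 = stmt-HodgeConjecture-24833)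
until rung 0 closes; count-neutral helper.
-/

set_option autoImplicit false
set_option linter.dupNamespace false   -- `Summit.HodgeConjecture.HodgeConjecture.…` (D-0017 nested layout; lakefile exemption for Summits)

noncomputable section

open MeasureTheory MeasureTheory.Measure Matrix Topology Polynomial
open scoped MatrixGroups NNReal ENNReal
open Literature.NumberTheory.Automorphic
open Literature.NumberTheory.GaloisRepresentations Literature.NumberTheory.GaloisRepresentations.IsNonarchimedeanLocalField

namespace Summit.HodgeConjecture.HodgeConjecture.Cruxes.H413.K2E3GL3CuspFormCancellationMaxParabolic

variable {F : Type*} [Field F] [ValuativeRel F] [TopologicalSpace F] [IsNonarchimedeanLocalField F] [MeasurableSpace F] [BorelSpace F]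
  {E : Type*} [NormedAddCommGroup E] [NormedSpace ℝ E]

/-! ## §1  Generic two-block parabolic of `GL_n(F)`: the `U`-orbit integral of a cusp form through a `U`-regular point vanishes -/

section Generic

variable {n : Type*} [Fintype n] [DecidableEq n] {c : n → Bool}

/-- **Cusp-form cancellation along `U_c` at a `U_c`-regular element of `P_c`** (generic two-block parabolic of `GL_n(F)`): if `det(1 − K_p) ≠ 0` and
`∫_{U} θ(x · u · (p y)) du = 0`, then `∫_{U} θ(x · u p u⁻¹ · y) du = 0` — substitute the twisted commutator `u ↦ u p u⁻¹ p⁻¹` (★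
`exists_homeomorph_unipotentRadicalGL_conj_eq`: a homeomorphism of `U_c` scaling Haar measure by `‖det(1 − K_p)‖⁻¹`), which multiplies `0`.
[cite: HarishChandra1970, Part VII §8 Lemma 57] [cite: Rogawski1990, §4.13, proof of Lemma 4.13.1, p. 70] -/
theorem integral_unipotent_conj_eq_zero_of_cuspForm
    [MeasurableSpace ↥(unipotentRadicalGL F c)] [BorelSpace ↥(unipotentRadicalGL F c)]
    (ν : Measure ↥(unipotentRadicalGL F c)) [IsHaarMeasure ν] (p : standardParabolicGL F c)
    (hp : (1 - Matrix.of fun q q' : {i : n // c i = false} × {j : n // c j = true} =>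
          ((p : GL n F) : Matrix n n F) q.1 q'.1 *
            (((p⁻¹ : standardParabolicGL F c) : GL n F) : Matrix n n F) q'.2 q.2).det ≠ 0)
    (θ : GL n F → E) (x y : GL n F)
    (hcusp : ∫ u : ↥(unipotentRadicalGL F c), θ (x * (u : GL n F) * ((p : GL n F) * y)) ∂ν = 0) :
    ∫ u : ↥(unipotentRadicalGL F c), θ (x * ((u : GL n F) * (p : GL n F) * ((u : GL n F))⁻¹) * y) ∂ν = 0 := by
  obtain ⟨T, hT, hTν⟩ := exists_homeomorph_unipotentRadicalGL_conj_eq ν p hp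
  have hpt : ∀ u : ↥(unipotentRadicalGL F c),
      θ (x * ((u : GL n F) * (p : GL n F) * ((u : GL n F))⁻¹) * y) =
        (fun v : ↥(unipotentRadicalGL F c) => θ (x * (v : GL n F) * ((p : GL n F) * y))) (T u) := fun u => by
    simp only [hT u, mul_assoc]
  simp_rw [hpt]
  rw [← show (T.toMeasurableEquiv : ↥(unipotentRadicalGL F c) → ↥(unipotentRadicalGL F c)) = T from T.toMeasurableEquiv_coe,
    ← integral_map_equiv T.toMeasurableEquiv (fun v : ↥(unipotentRadicalGL F c) => θ (x * (v : GL n F) * ((p : GL n F) * y))),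
    T.toMeasurableEquiv_coe, hTν, integral_smul_measure, hcusp, smul_zero]

/-- **The `∀ x y` form**, eating the cusp hypothesis in B4-J's shape «`∀ x y, ∫_U θ(x u y) du = 0`»: for a `U_c`-regular `p ∈ P_c`,
`∫_U θ(x · u p u⁻¹ · y) du = 0` for all `x, y`. [cite: HarishChandra1970, Part VII §8 Lemma 57] [cite: Rogawski1990, §4.13, proof of Lemma 4.13.1, p. 70] -/
theorem forall_integral_unipotent_conj_eq_zero_of_cuspForm
    [MeasurableSpace ↥(unipotentRadicalGL F c)] [BorelSpace ↥(unipotentRadicalGL F c)]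
    (ν : Measure ↥(unipotentRadicalGL F c)) [IsHaarMeasure ν] (p : standardParabolicGL F c)
    (hp : (1 - Matrix.of fun q q' : {i : n // c i = false} × {j : n // c j = true} =>
          ((p : GL n F) : Matrix n n F) q.1 q'.1 *
            (((p⁻¹ : standardParabolicGL F c) : GL n F) : Matrix n n F) q'.2 q.2).det ≠ 0)
    (θ : GL n F → E) (hcusp : ∀ x y : GL n F, ∫ u : ↥(unipotentRadicalGL F c), θ (x * (u : GL n F) * y) ∂ν = 0) (x y : GL n F) :
    ∫ u : ↥(unipotentRadicalGL F c), θ (x * ((u : GL n F) * (p : GL n F) * ((u : GL n F))⁻¹) * y) ∂ν = 0 :=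
  integral_unipotent_conj_eq_zero_of_cuspForm ν p hp θ x y (hcusp x _)

end Generic

/-! ## §2  `GL₃`, `U = N_{(2,1)}` (`c = (false, false, true)`): `det(1 − K_t) = λ⁻² · χ_A(λ)` for `t = diag(A, λ) ∈ M = GL₂ × GL₁` -/

section Parabolic21

omit [ValuativeRel F] [TopologicalSpace F] [IsNonarchimedeanLocalField F] [MeasurableSpace F] [BorelSpace F] in
/-- Entries of a block-diagonal `t ∈ M_{(2,1)}` and of its inverse: the off-diagonal blocks vanish and `(t⁻¹)₂₂ · t₂₂ = 1`. [folklore] -/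
theorem leviEntries_parabolic21 {t : GL (Fin 3) F} (ht : t ∈ standardLeviGL F (![false, false, true] : Fin 3 → Bool)) :
    (t : Matrix (Fin 3) (Fin 3) F) 0 2 = 0 ∧ (t : Matrix (Fin 3) (Fin 3) F) 1 2 = 0 ∧ (t : Matrix (Fin 3) (Fin 3) F) 2 0 = 0 ∧
      (t : Matrix (Fin 3) (Fin 3) F) 2 1 = 0 ∧
      ((t⁻¹ : GL (Fin 3) F) : Matrix (Fin 3) (Fin 3) F) 0 2 = 0 ∧ ((t⁻¹ : GL (Fin 3) F) : Matrix (Fin 3) (Fin 3) F) 1 2 = 0 ∧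
      ((t⁻¹ : GL (Fin 3) F) : Matrix (Fin 3) (Fin 3) F) 2 0 = 0 ∧ ((t⁻¹ : GL (Fin 3) F) : Matrix (Fin 3) (Fin 3) F) 2 1 = 0 ∧
      ((t⁻¹ : GL (Fin 3) F) : Matrix (Fin 3) (Fin 3) F) 2 2 * (t : Matrix (Fin 3) (Fin 3) F) 2 2 = 1 := by
  have h := (mem_standardLeviGL_iff (![false, false, true] : Fin 3 → Bool) t).1 ht
  have h' := (mem_standardLeviGL_iff (![false, false, true] : Fin 3 → Bool) t⁻¹).1 (Subgroup.inv_mem _ ht)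
  have h20 : ((t⁻¹ : GL (Fin 3) F) : Matrix (Fin 3) (Fin 3) F) 2 0 = 0 := h' 2 0 (by decide)
  have h21 : ((t⁻¹ : GL (Fin 3) F) : Matrix (Fin 3) (Fin 3) F) 2 1 = 0 := h' 2 1 (by decide)
  refine ⟨h 0 2 (by decide), h 1 2 (by decide), h 2 0 (by decide), h 2 1 (by decide), h' 0 2 (by decide), h' 1 2 (by decide), h20, h21, ?_⟩
  have hmul : (((t⁻¹ : GL (Fin 3) F) : Matrix (Fin 3) (Fin 3) F) * (t : Matrix (Fin 3) (Fin 3) F)) 2 2 = 1 := by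
    rw [← Units.val_mul, inv_mul_cancel, Units.val_one, Matrix.one_apply_eq]
  rw [Matrix.mul_apply, Fin.sum_univ_three, h20, h21, zero_mul, zero_mul, zero_add, zero_add] at hmul
  exact hmul

omit [ValuativeRel F] [TopologicalSpace F] [IsNonarchimedeanLocalField F] [MeasurableSpace F] [BorelSpace F] in
/-- The `2 × 2` characteristic polynomial evaluated: `χ_A(λ) = (λ − a₀₀)(λ − a₁₁) − a₀₁ a₁₀`. [folklore] -/
theorem eval_charpoly_fin_two (A : Matrix (Fin 2) (Fin 2) F) (lam : F) :
    A.charpoly.eval lam = (lam - A 0 0) * (lam - A 1 1) - A 0 1 * A 1 0 := by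
  rw [Matrix.charpoly_fin_two, Matrix.trace_fin_two, Matrix.det_fin_two]
  simp only [eval_add, eval_sub, eval_mul, eval_pow, eval_C, eval_X]
  ring

omit [ValuativeRel F] [TopologicalSpace F] [IsNonarchimedeanLocalField F] [MeasurableSpace F] [BorelSpace F] in
/-- **`det(1 − K_t) = (t⁻¹)₂₂² · χ_A(t₂₂)`** for `t = diag(A, λ) ∈ M_{(2,1)}` and the box `𝔲_{(2,1)} = {(0,2),(1,2)}` (`K_t = λ⁻¹ A`): the regularity hypothesis of
★ `exists_homeomorph_unipotentRadicalGL_conj_eq` in characteristic-polynomial currency. [cite: HarishChandra1970, Part VII §2] -/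
theorem det_one_sub_boxAd_parabolic21 (p : standardParabolicGL F (![false, false, true] : Fin 3 → Bool))
    (ht : (p : GL (Fin 3) F) ∈ standardLeviGL F (![false, false, true] : Fin 3 → Bool)) :
    (1 - Matrix.of fun q q' : {i : Fin 3 // (![false, false, true] : Fin 3 → Bool) i = false} × {j : Fin 3 // (![false, false, true] : Fin 3 → Bool) j = true} =>
        ((p : GL (Fin 3) F) : Matrix (Fin 3) (Fin 3) F) q.1 q'.1 *
          (((p⁻¹ : standardParabolicGL F (![false, false, true] : Fin 3 → Bool)) : GL (Fin 3) F) : Matrix (Fin 3) (Fin 3) F) q'.2 q.2).det =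
      (((p : GL (Fin 3) F)⁻¹ : GL (Fin 3) F) : Matrix (Fin 3) (Fin 3) F) 2 2 ^ 2 *
        (!![((p : GL (Fin 3) F) : Matrix (Fin 3) (Fin 3) F) 0 0, ((p : GL (Fin 3) F) : Matrix (Fin 3) (Fin 3) F) 0 1;
            ((p : GL (Fin 3) F) : Matrix (Fin 3) (Fin 3) F) 1 0, ((p : GL (Fin 3) F) : Matrix (Fin 3) (Fin 3) F) 1 1] : Matrix (Fin 2) (Fin 2) F).charpoly.eval
          (((p : GL (Fin 3) F) : Matrix (Fin 3) (Fin 3) F) 2 2) := by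
  classical
  set t : GL (Fin 3) F := (p : GL (Fin 3) F) with htdef
  have hpinv : ((p⁻¹ : standardParabolicGL F (![false, false, true] : Fin 3 → Bool)) : GL (Fin 3) F) = t⁻¹ := by rw [Subgroup.coe_inv]
  obtain ⟨-, -, -, -, -, -, -, -, hinv⟩ := leviEntries_parabolic21 ht
  -- reindex the two-element box `{(0,2), (1,2)}` by `Fin 2`
  let ι := {i : Fin 3 // (![false, false, true] : Fin 3 → Bool) i = false} × {j : Fin 3 // (![false, false, true] : Fin 3 → Bool) j = true}
  let e : Fin 2 ≃ ι :=
    { toFun := ![(⟨0, by decide⟩, ⟨2, by decide⟩), (⟨1, by decide⟩, ⟨2, by decide⟩)]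
      invFun := fun q => if (q.1 : Fin 3) = 0 then 0 else 1
      left_inv := by decide
      right_inv := by decide }
  set K : Matrix ι ι F := Matrix.of fun q q' : ι => (t : Matrix (Fin 3) (Fin 3) F) q.1 q'.1 * ((t⁻¹ : GL (Fin 3) F) : Matrix (Fin 3) (Fin 3) F) q'.2 q.2 with hK
  rw [hpinv, ← hK]
  have hdet : (1 - K).det = (Matrix.reindex e.symm e.symm (1 - K)).det := (Matrix.det_reindex_self e.symm (1 - K)).symm
  rw [hdet, Matrix.det_fin_two]
  have he0 : e 0 = (⟨0, by decide⟩, ⟨2, by decide⟩) := rfl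
  have he1 : e 1 = (⟨1, by decide⟩, ⟨2, by decide⟩) := rfl
  have h01 : e 0 ≠ e 1 := by decide
  simp only [Matrix.reindex_apply, Matrix.submatrix_apply, Equiv.symm_symm, Matrix.sub_apply, Matrix.one_apply_eq, Matrix.one_apply_ne h01,
    Matrix.one_apply_ne h01.symm]
  simp only [hK, Matrix.of_apply, he0, he1]
  rw [eval_charpoly_fin_two]
  simp only [Matrix.of_apply, Matrix.cons_val', Matrix.cons_val_zero, Matrix.cons_val_one, Matrix.empty_val', Matrix.cons_val_fin_one]
  set μ := ((t⁻¹ : GL (Fin 3) F) : Matrix (Fin 3) (Fin 3) F) 2 2 with hμ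
  set lam := (t : Matrix (Fin 3) (Fin 3) F) 2 2 with hlam
  linear_combination (((t : Matrix (Fin 3) (Fin 3) F) 0 0 + (t : Matrix (Fin 3) (Fin 3) F) 1 1) * μ - 1 - μ * lam) * hinv

/-- **B4-E1, `N_{(2,1)}`: cusp-form cancellation along the abelian unipotent radical `N_{(2,1)} ≤ GL₃(F)` at a regular Levi element.**  For
`t = diag(A, λ) ∈ M = GL₂ × GL₁` with `χ_A(λ) ≠ 0` (e.g. `t` regular in the mixed torus `E^× × F^×`) and `θ` a cusp form along `N_{(2,1)}`
(`∫_N θ(x u y) du = 0` for all `x, y`): **`∫_N θ(x · u t u⁻¹ · y) du = 0`** for all `x, y`. [cite: HarishChandra1970, Part VII §2, §8 Lemma 57]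
[cite: Rogawski1990, §4.13, proof of Lemma 4.13.1, p. 70] -/
theorem integral_unipotentRadical21_conj_eq_zero_of_cuspForm
    [MeasurableSpace ↥(unipotentRadicalGL F (![false, false, true] : Fin 3 → Bool))] [BorelSpace ↥(unipotentRadicalGL F (![false, false, true] : Fin 3 → Bool))]
    (ν : Measure ↥(unipotentRadicalGL F (![false, false, true] : Fin 3 → Bool))) [IsHaarMeasure ν]
    {t : GL (Fin 3) F} (ht : t ∈ standardLeviGL F (![false, false, true] : Fin 3 → Bool))
    (hreg : (!![(t : Matrix (Fin 3) (Fin 3) F) 0 0, (t : Matrix (Fin 3) (Fin 3) F) 0 1;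
              (t : Matrix (Fin 3) (Fin 3) F) 1 0, (t : Matrix (Fin 3) (Fin 3) F) 1 1] : Matrix (Fin 2) (Fin 2) F).charpoly.eval
            ((t : Matrix (Fin 3) (Fin 3) F) 2 2) ≠ 0)
    (θ : GL (Fin 3) F → E)
    (hcusp : ∀ x y : GL (Fin 3) F, ∫ u : ↥(unipotentRadicalGL F (![false, false, true] : Fin 3 → Bool)), θ (x * (u : GL (Fin 3) F) * y) ∂ν = 0)
    (x y : GL (Fin 3) F) :
    ∫ u : ↥(unipotentRadicalGL F (![false, false, true] : Fin 3 → Bool)), θ (x * ((u : GL (Fin 3) F) * t * ((u : GL (Fin 3) F))⁻¹) * y) ∂ν = 0 := by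
  obtain ⟨-, -, -, -, -, -, -, -, hinv⟩ := leviEntries_parabolic21 ht
  set p : standardParabolicGL F (![false, false, true] : Fin 3 → Bool) := ⟨t, standardLeviGL_le F _ ht⟩ with hp
  have hpt : (p : GL (Fin 3) F) = t := rfl
  have hdet := det_one_sub_boxAd_parabolic21 p (by rw [hpt]; exact ht)
  rw [hpt] at hdet
  have hne : (1 - Matrix.of fun q q' : {i : Fin 3 // (![false, false, true] : Fin 3 → Bool) i = false} ×
      {j : Fin 3 // (![false, false, true] : Fin 3 → Bool) j = true} =>
        ((p : GL (Fin 3) F) : Matrix (Fin 3) (Fin 3) F) q.1 q'.1 *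
          (((p⁻¹ : standardParabolicGL F (![false, false, true] : Fin 3 → Bool)) : GL (Fin 3) F) : Matrix (Fin 3) (Fin 3) F) q'.2 q.2).det ≠ 0 := by
    rw [hdet]
    exact mul_ne_zero (pow_ne_zero 2 (left_ne_zero_of_mul_eq_one hinv)) hreg
  exact forall_integral_unipotent_conj_eq_zero_of_cuspForm ν p hne θ hcusp x y

end Parabolic21

/-! ## §3  `GL₃`, the OPPOSITE radical `U = N̄_{(2,1)}` (`c = (true, true, false)`): `det(1 − K_t) · det A = χ_A(λ)` -/

section OppositeParabolic21

omit [ValuativeRel F] [TopologicalSpace F] [IsNonarchimedeanLocalField F] [MeasurableSpace F] [BorelSpace F] in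
/-- A block-diagonal `t ∈ M_{(2,1)}` lies in the opposite parabolic `P̄_{(2,1)} = P_{(true,true,false)}` (lower block triangular). [folklore] -/
theorem mem_oppositeParabolic21_of_mem_levi {t : GL (Fin 3) F} (ht : t ∈ standardLeviGL F (![false, false, true] : Fin 3 → Bool)) :
    t ∈ standardParabolicGL F (![true, true, false] : Fin 3 → Bool) := by
  obtain ⟨h02, h12, -, -, -⟩ := leviEntries_parabolic21 ht
  rw [mem_standardParabolicGL_iff]
  intro i j hij
  fin_cases i <;> fin_cases j <;> first | exact absurd hij (by decide) | assumption

omit [ValuativeRel F] [TopologicalSpace F] [IsNonarchimedeanLocalField F] [MeasurableSpace F] [BorelSpace F] in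
/-- For `t = diag(A, λ) ∈ M_{(2,1)}` with inverse `t⁻¹ = diag(S, μ)`: `S · A = 1₂`. [folklore] -/
theorem inv_topLeftBlock_mul_topLeftBlock {t : GL (Fin 3) F} (ht : t ∈ standardLeviGL F (![false, false, true] : Fin 3 → Bool)) :
    (!![((t⁻¹ : GL (Fin 3) F) : Matrix (Fin 3) (Fin 3) F) 0 0, ((t⁻¹ : GL (Fin 3) F) : Matrix (Fin 3) (Fin 3) F) 0 1;
        ((t⁻¹ : GL (Fin 3) F) : Matrix (Fin 3) (Fin 3) F) 1 0, ((t⁻¹ : GL (Fin 3) F) : Matrix (Fin 3) (Fin 3) F) 1 1] : Matrix (Fin 2) (Fin 2) F) *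
      !![(t : Matrix (Fin 3) (Fin 3) F) 0 0, (t : Matrix (Fin 3) (Fin 3) F) 0 1; (t : Matrix (Fin 3) (Fin 3) F) 1 0, (t : Matrix (Fin 3) (Fin 3) F) 1 1] = 1 := by
  obtain ⟨-, -, h20, h21, -⟩ := leviEntries_parabolic21 ht
  have hmul : ((t⁻¹ : GL (Fin 3) F) : Matrix (Fin 3) (Fin 3) F) * (t : Matrix (Fin 3) (Fin 3) F) = 1 := by
    rw [← Units.val_mul, inv_mul_cancel, Units.val_one]
  have hent : ∀ i j : Fin 3, ∑ l : Fin 3, ((t⁻¹ : GL (Fin 3) F) : Matrix (Fin 3) (Fin 3) F) i l * (t : Matrix (Fin 3) (Fin 3) F) l j =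
      (1 : Matrix (Fin 3) (Fin 3) F) i j := fun i j => by
    rw [← Matrix.mul_apply, hmul]
  ext i j
  fin_cases i <;> fin_cases j
  · simpa [Matrix.mul_apply, Fin.sum_univ_two, Fin.sum_univ_three, h20] using hent 0 0
  · simpa [Matrix.mul_apply, Fin.sum_univ_two, Fin.sum_univ_three, h21] using hent 0 1
  · simpa [Matrix.mul_apply, Fin.sum_univ_two, Fin.sum_univ_three, h20] using hent 1 0
  · simpa [Matrix.mul_apply, Fin.sum_univ_two, Fin.sum_univ_three, h21] using hent 1 1

omit [ValuativeRel F] [TopologicalSpace F] [IsNonarchimedeanLocalField F] [MeasurableSpace F] [BorelSpace F] in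
/-- **`det(1 − K_t) · det A = χ_A(λ)`** for `t = diag(A, λ) ∈ M_{(2,1)}` and the box `𝔲̄_{(2,1)} = {(2,0),(2,1)}` of the OPPOSITE radical (`K_t = λ (A⁻¹)ᵀ`,
`(1 − λA⁻¹) A = A − λ`). [cite: HarishChandra1970, Part VII §2] -/
theorem det_one_sub_boxAd_oppositeParabolic21_mul_det (p : standardParabolicGL F (![true, true, false] : Fin 3 → Bool))
    (ht : (p : GL (Fin 3) F) ∈ standardLeviGL F (![false, false, true] : Fin 3 → Bool)) :
    (1 - Matrix.of fun q q' : {i : Fin 3 // (![true, true, false] : Fin 3 → Bool) i = false} × {j : Fin 3 // (![true, true, false] : Fin 3 → Bool) j = true} =>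
        ((p : GL (Fin 3) F) : Matrix (Fin 3) (Fin 3) F) q.1 q'.1 *
          (((p⁻¹ : standardParabolicGL F (![true, true, false] : Fin 3 → Bool)) : GL (Fin 3) F) : Matrix (Fin 3) (Fin 3) F) q'.2 q.2).det *
        (!![((p : GL (Fin 3) F) : Matrix (Fin 3) (Fin 3) F) 0 0, ((p : GL (Fin 3) F) : Matrix (Fin 3) (Fin 3) F) 0 1;
            ((p : GL (Fin 3) F) : Matrix (Fin 3) (Fin 3) F) 1 0, ((p : GL (Fin 3) F) : Matrix (Fin 3) (Fin 3) F) 1 1] : Matrix (Fin 2) (Fin 2) F).det =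
      (!![((p : GL (Fin 3) F) : Matrix (Fin 3) (Fin 3) F) 0 0, ((p : GL (Fin 3) F) : Matrix (Fin 3) (Fin 3) F) 0 1;
          ((p : GL (Fin 3) F) : Matrix (Fin 3) (Fin 3) F) 1 0, ((p : GL (Fin 3) F) : Matrix (Fin 3) (Fin 3) F) 1 1] : Matrix (Fin 2) (Fin 2) F).charpoly.eval
        (((p : GL (Fin 3) F) : Matrix (Fin 3) (Fin 3) F) 2 2) := by
  classical
  set t : GL (Fin 3) F := (p : GL (Fin 3) F) with htdef
  have hpinv : ((p⁻¹ : standardParabolicGL F (![true, true, false] : Fin 3 → Bool)) : GL (Fin 3) F) = t⁻¹ := by rw [Subgroup.coe_inv]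
  have hSA := inv_topLeftBlock_mul_topLeftBlock ht
  -- reindex the two-element box `{(2,0), (2,1)}` by `Fin 2`
  let ι := {i : Fin 3 // (![true, true, false] : Fin 3 → Bool) i = false} × {j : Fin 3 // (![true, true, false] : Fin 3 → Bool) j = true}
  let e : Fin 2 ≃ ι :=
    { toFun := ![(⟨2, by decide⟩, ⟨0, by decide⟩), (⟨2, by decide⟩, ⟨1, by decide⟩)]
      invFun := fun q => if (q.2 : Fin 3) = 0 then 0 else 1
      left_inv := by decide
      right_inv := by decide }
  set K : Matrix ι ι F := Matrix.of fun q q' : ι => (t : Matrix (Fin 3) (Fin 3) F) q.1 q'.1 * ((t⁻¹ : GL (Fin 3) F) : Matrix (Fin 3) (Fin 3) F) q'.2 q.2 with hK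
  rw [hpinv, ← hK]
  have hdet : (1 - K).det = (Matrix.reindex e.symm e.symm (1 - K)).det := (Matrix.det_reindex_self e.symm (1 - K)).symm
  have he0 : e 0 = (⟨2, by decide⟩, ⟨0, by decide⟩) := rfl
  have he1 : e 1 = (⟨2, by decide⟩, ⟨1, by decide⟩) := rfl
  have h01 : e 0 ≠ e 1 := by decide
  -- `det(1 − K) = det(1 − λ S)` with `S` the top-left block of `t⁻¹`
  set lam : F := (t : Matrix (Fin 3) (Fin 3) F) 2 2 with hlam
  set S2 : Matrix (Fin 2) (Fin 2) F := !![((t⁻¹ : GL (Fin 3) F) : Matrix (Fin 3) (Fin 3) F) 0 0, ((t⁻¹ : GL (Fin 3) F) : Matrix (Fin 3) (Fin 3) F) 0 1;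
      ((t⁻¹ : GL (Fin 3) F) : Matrix (Fin 3) (Fin 3) F) 1 0, ((t⁻¹ : GL (Fin 3) F) : Matrix (Fin 3) (Fin 3) F) 1 1] with hS2
  set A2 : Matrix (Fin 2) (Fin 2) F := !![(t : Matrix (Fin 3) (Fin 3) F) 0 0, (t : Matrix (Fin 3) (Fin 3) F) 0 1;
      (t : Matrix (Fin 3) (Fin 3) F) 1 0, (t : Matrix (Fin 3) (Fin 3) F) 1 1] with hA2
  have hK1 : (1 - K).det = (1 - lam • S2).det := by
    rw [hdet, Matrix.det_fin_two, Matrix.det_fin_two]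
    simp only [Matrix.reindex_apply, Matrix.submatrix_apply, Equiv.symm_symm, Matrix.sub_apply, Matrix.one_apply_eq, Matrix.one_apply_ne h01,
      Matrix.one_apply_ne h01.symm, Matrix.smul_apply, smul_eq_mul]
    simp only [hK, Matrix.of_apply, he0, he1, hS2, Matrix.cons_val', Matrix.cons_val_zero, Matrix.cons_val_one, Matrix.empty_val',
      Matrix.cons_val_fin_one, Matrix.one_apply_ne (show (0 : Fin 2) ≠ 1 by decide), Matrix.one_apply_ne (show (1 : Fin 2) ≠ 0 by decide)]
    ring
  have hkey : (1 - lam • S2) * A2 = A2 - lam • (1 : Matrix (Fin 2) (Fin 2) F) := by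
    rw [sub_mul, one_mul, smul_mul_assoc, hSA]
  rw [hK1, ← Matrix.det_mul, hkey, eval_charpoly_fin_two, Matrix.det_fin_two]
  simp only [hA2, Matrix.sub_apply, Matrix.smul_apply, Matrix.one_apply_eq, Matrix.one_apply_ne (show (0 : Fin 2) ≠ 1 by decide),
    Matrix.one_apply_ne (show (1 : Fin 2) ≠ 0 by decide), smul_eq_mul, mul_one, mul_zero, sub_zero, Matrix.of_apply, Matrix.cons_val',
    Matrix.cons_val_zero, Matrix.cons_val_one, Matrix.empty_val', Matrix.cons_val_fin_one]
  ring

/-- **B4-E1, `N̄_{(2,1)}`: cusp-form cancellation along the opposite abelian unipotent radical `N̄_{(2,1)} ≤ GL₃(F)` at a regular Levi element.**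
For `t = diag(A, λ) ∈ M = GL₂ × GL₁` with `χ_A(λ) ≠ 0` and `θ` a cusp form along `N̄_{(2,1)}`: **`∫_{N̄} θ(x · v t v⁻¹ · y) dv = 0`** for all `x, y`.
[cite: HarishChandra1970, Part VII §2, §8 Lemma 57] [cite: Rogawski1990, §4.13, proof of Lemma 4.13.1, p. 70] -/
theorem integral_oppositeUnipotentRadical21_conj_eq_zero_of_cuspForm
    [MeasurableSpace ↥(unipotentRadicalGL F (![true, true, false] : Fin 3 → Bool))] [BorelSpace ↥(unipotentRadicalGL F (![true, true, false] : Fin 3 → Bool))]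
    (ν : Measure ↥(unipotentRadicalGL F (![true, true, false] : Fin 3 → Bool))) [IsHaarMeasure ν]
    {t : GL (Fin 3) F} (ht : t ∈ standardLeviGL F (![false, false, true] : Fin 3 → Bool))
    (hreg : (!![(t : Matrix (Fin 3) (Fin 3) F) 0 0, (t : Matrix (Fin 3) (Fin 3) F) 0 1;
              (t : Matrix (Fin 3) (Fin 3) F) 1 0, (t : Matrix (Fin 3) (Fin 3) F) 1 1] : Matrix (Fin 2) (Fin 2) F).charpoly.eval
            ((t : Matrix (Fin 3) (Fin 3) F) 2 2) ≠ 0)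
    (θ : GL (Fin 3) F → E)
    (hcusp : ∀ x y : GL (Fin 3) F, ∫ v : ↥(unipotentRadicalGL F (![true, true, false] : Fin 3 → Bool)), θ (x * (v : GL (Fin 3) F) * y) ∂ν = 0)
    (x y : GL (Fin 3) F) :
    ∫ v : ↥(unipotentRadicalGL F (![true, true, false] : Fin 3 → Bool)), θ (x * ((v : GL (Fin 3) F) * t * ((v : GL (Fin 3) F))⁻¹) * y) ∂ν = 0 := by
  set p : standardParabolicGL F (![true, true, false] : Fin 3 → Bool) := ⟨t, mem_oppositeParabolic21_of_mem_levi ht⟩ with hp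
  have hpt : (p : GL (Fin 3) F) = t := rfl
  have hdet := det_one_sub_boxAd_oppositeParabolic21_mul_det p (by rw [hpt]; exact ht)
  rw [hpt] at hdet
  have hne : (1 - Matrix.of fun q q' : {i : Fin 3 // (![true, true, false] : Fin 3 → Bool) i = false} ×
      {j : Fin 3 // (![true, true, false] : Fin 3 → Bool) j = true} =>
        ((p : GL (Fin 3) F) : Matrix (Fin 3) (Fin 3) F) q.1 q'.1 *
          (((p⁻¹ : standardParabolicGL F (![true, true, false] : Fin 3 → Bool)) : GL (Fin 3) F) : Matrix (Fin 3) (Fin 3) F) q'.2 q.2).det ≠ 0 := by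
    intro h0
    rw [h0, zero_mul] at hdet
    exact hreg hdet.symm
  exact forall_integral_unipotent_conj_eq_zero_of_cuspForm ν p hne θ hcusp x y

end OppositeParabolic21

end Summit.HodgeConjecture.HodgeConjecture.Cruxes.H413.K2E3GL3CuspFormCancellationMaxParabolic
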